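import Mathlib
import HarnessLib
import Literature.Probability.MarkovChains.DataAugmentationAutocovarianceLags
import Literature.Probability.MarkovChains.DataAugmentationRaoBlackwell
import Literature.Probability.MarkovChains.ExponentialAutocorrelation
import Literature.Probability.MarkovChains.LpDistance

/-!
# Autocovariances of a data-augmentation chain are log-convex in the lag, so they decay no faster than `ρ₁ᵏ` and `τ_int ≥ (1 + ρ₁)/(1 − ρ₁)` (Liu 2001 §12.6 with Thm 6.6.1; Berg 2004 §4.1)

HONEST FRAMING: exact (Metropolis-corrected) sampling algorithms for lattice gauge theory; figures
of merit are autocorrelation/cost numbers at stated couplings and volumes; no continuum-physics claim.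

Sources.  J. S. Liu, *Monte Carlo Strategies in Scientific Computing*, Springer 2001
[Liu2001MonteCarlo]: §6.6.1 Thm 6.6.1 and (6.7) (the marginal chain of data augmentation has
autocovariances `cov{h(x⁽⁰⁾), h(x⁽ᵏ⁾)}` that are "non-negative and monotone nonincreasing"; typed in
`DataAugmentationAutocovariance(Lags).lean`), §13.2.1 (the forward operator is `F₁ = E[E{· | x₂} | x₁]`,
self-adjoint and positive) and §12.6 (held copy, page file p0255: for a reversible chain the lag-`n`
autocorrelation is a mixture of powers, "`ρ_n(h) = ⟨Fⁿh, h⟩/⟨h, h⟩ = (c₁²λ₁ⁿ + c₂²λ₂ⁿ + ⋯)/(c₁² + c₂² + ⋯)`").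
B. A. Berg, *Markov Chain Monte Carlo Simulations and Their Statistical Analysis*, 2004 [Berg2004],
§4.1 (4.12)/(4.14) (`τ_int = 1 + 2Σ_t ĉ(t)`, the window `τ_int(t)`; typed in `ExponentialAutocorrelation.lean`
as `tauIntInf`, `tauIntWindow`, with the single-exponential value `(1 + r)/(1 − r)`).

What is proved (finite spaces; `J : X → U → ℝ` a joint law with `J ≥ 0` and positive marginals
`p`, `m`; `A₁ = daKernel J`; `C_k(g) = ⟨g, A₁ᵏ g⟩_p`): the book's mixture-of-powers representation makes
`k ↦ C_k` a moment sequence of a measure on `[0, 1]` (the spectrum of the positive operator `F₁`), hence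
LOG-CONVEX; here this consequence is proved WITHOUT the spectral theorem, by Cauchy–Schwarz through the
half-step conditional expectations `E{· | u}` / `E{· | x}` (`daCondExp`, `daCondExp_adjoint`):

* **`da_autocov_logConvex`** — `C_{k+1}(g)² ≤ C_k(g) C_{k+2}(g)` for every `k` and `g`
  (odd middle index: `⟨v, A₁v⟩² ≤ ‖v‖²‖A₁v‖²` with `v = A₁ʲ g`; even middle index:
  `‖A₁ v‖⁴ = ⟨E{A₁v | u}, E{v | u}⟩_m² ≤ ⟨v, A₁ v⟩⟨A₁v, A₁² v⟩`);
* **`da_autocov_ratio_mono`** — `C_{k+1} C_0 ≥ C_k C_1`, and **`da_autocov_ge_geometric`** —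
  `C_k ≥ C_0 ρ₁ᵏ` with `ρ₁ = C_1/C_0` (the autocorrelations of a data-augmentation / two-block Gibbs chain
  never decay faster than geometrically at the lag-one rate: Jensen on the book's mixture of powers);
* **`da_tauIntWindow_ge`** — `τ_int(t) ≥ 1 + 2(ρ₁ − ρ₁^{t+1})/(1 − ρ₁)` for every window `t`, and
  **`da_tauIntInf_ge`** — `τ_int ≥ (1 + ρ₁)/(1 − ρ₁)` (when the autocorrelations are summable), for the
  stationary autocovariance function `C_k(ḡ)` of any observable.

NOT CLAIMED: the spectral representation itself (see `SpectralRepresentation.lean`); anything for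
non-positive reversible chains (where only the even lags are log-convex); `τ_exp`.

Context (cell pub-lqcd, venture LatticeQCDFlow): for every exact two-block / auxiliary-variable update
(heat-bath data augmentation, Swendsen–Wang) a measured lag-one autocorrelation `ρ₁` of an observable
certifies `τ_int ≥ (1 + ρ₁)/(1 − ρ₁)` for that observable — a one-number lower bound on the cost.
-/

namespace Literature.Probability.MarkovChains

open Finset Matrix

variable {X U : Type*} [Fintype X] [Fintype U] [DecidableEq X] {J : X → U → ℝ}

/-! ## Half steps -/

omit [DecidableEq X] in
/-- `⟨v, A₁ v⟩_p = ‖E{v | u}‖²_m` in inner-product form. [cite: Liu2001MonteCarlo, §6.6.1 Thm 6.6.1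
(proof: `= E_π[E_π{h(x₁)|x₂}]²`)] -/
theorem piInner_daKernel_mulVec_eq_piInner_daCondExp (hp : ∀ x, 0 < ∑ u, J x u)
    (hm : ∀ u, 0 < ∑ x, J x u) (v : X → ℝ) :
    piInner (fun x => ∑ u, J x u) v (daKernel J *ᵥ v)
      = piInner (fun u => ∑ z, J z u) (daCondExp J v) (daCondExp J v) := by
  rw [piInner_daKernel_mulVec hp hm]
  unfold piInner
  exact sum_congr rfl fun u _ => by rw [sq]

omit [DecidableEq X] in
/-- `⟨w, A₁ v⟩_p = ⟨E{w | u}, E{v | u}⟩_m` (`A₁ = E[E{· | u} | x]` and adjointness of the two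
conditional expectations). [cite: Liu2001MonteCarlo, §13.2.1 (`F₁ h = E[E{h(x₁)|x₂}|x₁]`, "the two
forward operators are self-adjoint")] -/
theorem piInner_daKernel_mulVec_eq_piInner_daCondExp' (hp : ∀ x, 0 < ∑ u, J x u)
    (hm : ∀ u, 0 < ∑ x, J x u) (w v : X → ℝ) :
    piInner (fun x => ∑ u, J x u) w (daKernel J *ᵥ v)
      = piInner (fun u => ∑ z, J z u) (daCondExp J w) (daCondExp J v) := by
  unfold piInner
  simp_rw [daKernel_mulVec_eq_daCondExp]
  rw [← daCondExp_adjoint hp hm w (daCondExp J v)]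

/-! ## Log-convexity -/

/-- Odd middle index: `C_{2j+1}² ≤ C_{2j} C_{2j+2}` (`⟨v, A₁ v⟩² ≤ ‖v‖² ‖A₁ v‖²`, `v = A₁ʲ g`).
[cite: Liu2001MonteCarlo, §12.6 (display `ρ_n(h) = Σ cᵢ²λᵢⁿ/Σ cᵢ²`, held copy page file p0255) with
§6.6.1 (6.7)] -/
theorem da_autocov_logConvex_odd (hp : ∀ x, 0 < ∑ u, J x u) (hm : ∀ u, 0 < ∑ x, J x u) (j : ℕ)
    (g : X → ℝ) :
    piInner (fun x => ∑ u, J x u) g ((daKernel J ^ (2 * j + 1)) *ᵥ g) ^ 2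
      ≤ piInner (fun x => ∑ u, J x u) g ((daKernel J ^ (2 * j)) *ᵥ g)
        * piInner (fun x => ∑ u, J x u) g ((daKernel J ^ (2 * (j + 1))) *ᵥ g) := by
  have hπ0 : ∀ x, 0 ≤ ∑ u, J x u := fun x => (hp x).le
  have hAv : (daKernel J ^ (j + 1)) *ᵥ g = daKernel J *ᵥ ((daKernel J ^ j) *ᵥ g) := by
    rw [pow_succ', ← mulVec_mulVec]
  rw [da_pow_odd_eq hp hm, da_pow_even_eq hp hm, da_pow_even_eq hp hm, hAv]
  exact piInner_sq_le_mul hπ0 _ _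

/-- Even middle index: `C_{2j+2}² ≤ C_{2j+1} C_{2j+3}`
(`‖A₁v‖⁴ = ⟨E{A₁ v | u}, E{v | u}⟩_m² ≤ ‖E{A₁v|u}‖²_m ‖E{v|u}‖²_m = ⟨A₁v, A₁²v⟩ ⟨v, A₁v⟩`).
[cite: Liu2001MonteCarlo, §12.6 (display `ρ_n(h) = Σ cᵢ²λᵢⁿ/Σ cᵢ²`) with §13.2.1] -/
theorem da_autocov_logConvex_even (hJ : ∀ x u, 0 ≤ J x u) (hp : ∀ x, 0 < ∑ u, J x u)
    (hm : ∀ u, 0 < ∑ x, J x u) (j : ℕ) (g : X → ℝ) :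
    piInner (fun x => ∑ u, J x u) g ((daKernel J ^ (2 * (j + 1))) *ᵥ g) ^ 2
      ≤ piInner (fun x => ∑ u, J x u) g ((daKernel J ^ (2 * j + 1)) *ᵥ g)
        * piInner (fun x => ∑ u, J x u) g ((daKernel J ^ (2 * (j + 1) + 1)) *ᵥ g) := by
  have hm0 : ∀ u, 0 ≤ ∑ z, J z u := fun u => sum_nonneg fun z _ => hJ z u
  set v := (daKernel J ^ j) *ᵥ g with hv
  have hAv : (daKernel J ^ (j + 1)) *ᵥ g = daKernel J *ᵥ v := by
    rw [hv, mulVec_mulVec, ← pow_succ']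
  rw [da_pow_even_eq hp hm, da_pow_odd_eq hp hm, da_pow_odd_eq hp hm, hAv,
    piInner_daKernel_mulVec_eq_piInner_daCondExp' hp hm,
    piInner_daKernel_mulVec_eq_piInner_daCondExp hp hm,
    piInner_daKernel_mulVec_eq_piInner_daCondExp hp hm, mul_comm]
  exact piInner_sq_le_mul hm0 _ _

/-- **LOG-CONVEXITY of the autocovariances of a data-augmentation chain**:
`C_{k+1}(g)² ≤ C_k(g) · C_{k+2}(g)`, `C_k(g) = ⟨g, A₁ᵏ g⟩_p`, for every `k` and every `g`.
[cite: Liu2001MonteCarlo, §12.6 (display `ρ_n(h) = (c₁²λ₁ⁿ + c₂²λ₂ⁿ + ⋯)/(c₁² + c₂² + ⋯)`: a mixture of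
powers of the (here non-negative) eigenvalues) with §6.6.1 Thm 6.6.1 / (6.7)] -/
theorem da_autocov_logConvex (hJ : ∀ x u, 0 ≤ J x u) (hp : ∀ x, 0 < ∑ u, J x u)
    (hm : ∀ u, 0 < ∑ x, J x u) (k : ℕ) (g : X → ℝ) :
    piInner (fun x => ∑ u, J x u) g ((daKernel J ^ (k + 1)) *ᵥ g) ^ 2
      ≤ piInner (fun x => ∑ u, J x u) g ((daKernel J ^ k) *ᵥ g)
        * piInner (fun x => ∑ u, J x u) g ((daKernel J ^ (k + 2)) *ᵥ g) := by
  obtain ⟨j, rfl | rfl⟩ := Nat.even_or_odd' k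
  · have h := da_autocov_logConvex_odd hp hm j g
    rwa [show 2 * (j + 1) = 2 * j + 2 by ring] at h
  · have h := da_autocov_logConvex_even hJ hp hm j g
    rwa [show 2 * (j + 1) = 2 * j + 1 + 1 by ring, show 2 * j + 1 + 1 + 1 = 2 * j + 1 + 2 by ring]
      at h

/-! ## Geometric lower bound at the lag-one rate -/

/-- **The successive ratios do not decrease**: `C_{k+1} C_0 ≥ C_k C_1` for every `k`.
[cite: Liu2001MonteCarlo, §12.6 (display `ρ_n(h) = Σ cᵢ²λᵢⁿ/Σ cᵢ²`) with §6.6.1] -/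
theorem da_autocov_ratio_mono (hJ : ∀ x u, 0 ≤ J x u) (hp : ∀ x, 0 < ∑ u, J x u)
    (hm : ∀ u, 0 < ∑ x, J x u) (g : X → ℝ) (k : ℕ) :
    piInner (fun x => ∑ u, J x u) g ((daKernel J ^ k) *ᵥ g)
        * piInner (fun x => ∑ u, J x u) g ((daKernel J ^ 1) *ᵥ g)
      ≤ piInner (fun x => ∑ u, J x u) g ((daKernel J ^ (k + 1)) *ᵥ g)
        * piInner (fun x => ∑ u, J x u) g ((daKernel J ^ 0) *ᵥ g) := by
  set C : ℕ → ℝ := fun n => piInner (fun x => ∑ u, J x u) g ((daKernel J ^ n) *ᵥ g) with hC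
  have hC0 : ∀ n, 0 ≤ C n := fun n => da_autocov_nonneg hJ hp hm n g
  have hlc : ∀ n, C (n + 1) ^ 2 ≤ C n * C (n + 2) := fun n => da_autocov_logConvex hJ hp hm n g
  show C k * C 1 ≤ C (k + 1) * C 0
  induction k with
  | zero => simp [mul_comm]
  | succ k ih =>
    -- `C_k (C_{k+2} C_0 − C_{k+1} C_1) ≥ 0`, and `C_k = 0 ⇒ C_{k+1} = 0`
    have h1 := hlc k
    rcases (hC0 k).eq_or_lt with hk0 | hkpos
    · have : C (k + 1) = 0 := by
        have := h1; rw [← hk0, zero_mul] at this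
        exact pow_eq_zero_iff (n := 2) (by norm_num) |>.mp (le_antisymm this (sq_nonneg _))
      rw [this, zero_mul]
      exact mul_nonneg (hC0 _) (hC0 _)
    · have key : C k * (C (k + 1) * C 1) ≤ C k * (C (k + 2) * C 0) := by
        calc C k * (C (k + 1) * C 1) = C (k + 1) * (C k * C 1) := by ring
          _ ≤ C (k + 1) * (C (k + 1) * C 0) := mul_le_mul_of_nonneg_left ih (hC0 _)
          _ = C (k + 1) ^ 2 * C 0 := by ring
          _ ≤ C k * C (k + 2) * C 0 := mul_le_mul_of_nonneg_right h1 (hC0 0)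
          _ = C k * (C (k + 2) * C 0) := by ring
      exact le_of_mul_le_mul_left key hkpos

/-- **`C_k ≥ C_0 ρ₁ᵏ`** with `ρ₁ = C_1/C_0` (`C_0 > 0`): the autocovariances of a data-augmentation
chain decay no faster than geometrically at the lag-one rate (Jensen's inequality on the book's mixture
of powers, here from log-convexity). [cite: Liu2001MonteCarlo, §12.6 (display `ρ_n(h) = Σ cᵢ²λᵢⁿ/Σ cᵢ²`)
with §6.6.1 Thm 6.6.1] -/
theorem da_autocov_ge_geometric (hJ : ∀ x u, 0 ≤ J x u) (hp : ∀ x, 0 < ∑ u, J x u)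
    (hm : ∀ u, 0 < ∑ x, J x u) (g : X → ℝ)
    (h0 : 0 < piInner (fun x => ∑ u, J x u) g g) (k : ℕ) :
    piInner (fun x => ∑ u, J x u) g g
        * (piInner (fun x => ∑ u, J x u) g (daKernel J *ᵥ g) / piInner (fun x => ∑ u, J x u) g g) ^ k
      ≤ piInner (fun x => ∑ u, J x u) g ((daKernel J ^ k) *ᵥ g) := by
  set C : ℕ → ℝ := fun n => piInner (fun x => ∑ u, J x u) g ((daKernel J ^ n) *ᵥ g) with hC
  have hC0 : C 0 = piInner (fun x => ∑ u, J x u) g g := by simp [hC]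
  have hC1 : C 1 = piInner (fun x => ∑ u, J x u) g (daKernel J *ᵥ g) := by simp [hC]
  have hr0 : 0 ≤ C 1 / C 0 := div_nonneg (da_autocov_nonneg hJ hp hm 1 g) (hC0 ▸ h0).le
  rw [← hC0, ← hC1]
  show C 0 * (C 1 / C 0) ^ k ≤ C k
  induction k with
  | zero => simp
  | succ k ih =>
    have hmono := da_autocov_ratio_mono hJ hp hm g k
    have hC0pos : 0 < C 0 := hC0 ▸ h0
    -- `C_{k+1} ≥ C_k C_1 / C_0 ≥ C_0 ρ₁ᵏ ρ₁`
    have h1 : C k * (C 1 / C 0) ≤ C (k + 1) := by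
      rw [mul_div_assoc', div_le_iff₀ hC0pos]
      exact hmono
    calc C 0 * (C 1 / C 0) ^ (k + 1) = C 0 * (C 1 / C 0) ^ k * (C 1 / C 0) := by ring
      _ ≤ C k * (C 1 / C 0) := mul_le_mul_of_nonneg_right ih hr0
      _ ≤ C (k + 1) := h1

/-! ## The integrated autocorrelation time is at least the single-exponential value at rate `ρ₁` -/

/-- Normalised: `ĉ(k) = C_k/C_0 ≥ ρ₁ᵏ`. [cite: Liu2001MonteCarlo, §12.6 (display `ρ_n(h) = …`);
Berg2004, §4.1 (the normalised autocorrelation function `ĉ(t)`)] -/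
theorem da_autocorr_ge_pow (hJ : ∀ x u, 0 ≤ J x u) (hp : ∀ x, 0 < ∑ u, J x u)
    (hm : ∀ u, 0 < ∑ x, J x u) (g : X → ℝ)
    (h0 : 0 < piInner (fun x => ∑ u, J x u) g g) (k : ℕ) :
    (piInner (fun x => ∑ u, J x u) g (daKernel J *ᵥ g) / piInner (fun x => ∑ u, J x u) g g) ^ k
      ≤ piInner (fun x => ∑ u, J x u) g ((daKernel J ^ k) *ᵥ g)
          / piInner (fun x => ∑ u, J x u) g ((daKernel J ^ 0) *ᵥ g) := by
  have h := da_autocov_ge_geometric hJ hp hm g h0 k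
  rw [pow_zero, one_mulVec, le_div_iff₀ h0, mul_comm]
  exact h

/-- **`τ_int(t) ≥ 1 + 2(ρ₁ − ρ₁^{t+1})/(1 − ρ₁)`** for every window `t` (`ρ₁ = C_1/C_0 < 1`), for the
autocovariance function `C_k = ⟨g, A₁ᵏ g⟩_p` of a data-augmentation chain (apply to `g = h − E_p h`).
[cite: Berg2004, §4.1 eq. (4.14)–(4.16); Liu2001MonteCarlo, §12.6 with §6.6.1] -/
theorem da_tauIntWindow_ge (hJ : ∀ x u, 0 ≤ J x u) (hp : ∀ x, 0 < ∑ u, J x u)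
    (hm : ∀ u, 0 < ∑ x, J x u) (g : X → ℝ)
    (h0 : 0 < piInner (fun x => ∑ u, J x u) g g)
    (hr1 : piInner (fun x => ∑ u, J x u) g (daKernel J *ᵥ g) < piInner (fun x => ∑ u, J x u) g g)
    (t : ℕ) :
    1 + 2 * ((piInner (fun x => ∑ u, J x u) g (daKernel J *ᵥ g) / piInner (fun x => ∑ u, J x u) g g
          - (piInner (fun x => ∑ u, J x u) g (daKernel J *ᵥ g)
              / piInner (fun x => ∑ u, J x u) g g) ^ (t + 1))
        / (1 - piInner (fun x => ∑ u, J x u) g (daKernel J *ᵥ g) / piInner (fun x => ∑ u, J x u) g g))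
      ≤ tauIntWindow (fun k => piInner (fun x => ∑ u, J x u) g ((daKernel J ^ k) *ᵥ g)) t := by
  set r := piInner (fun x => ∑ u, J x u) g (daKernel J *ᵥ g) / piInner (fun x => ∑ u, J x u) g g
    with hr
  have hrlt : r < 1 := (div_lt_one h0).mpr hr1
  -- the geometric comparison function `k ↦ C_0 r^k`
  have hgeom := tauIntWindow_geometric (C := fun k => piInner (fun x => ∑ u, J x u) g g * r ^ k)
    (c := piInner (fun x => ∑ u, J x u) g g) (r := r) (fun k => rfl) h0.ne' hrlt.ne t
  rw [← hgeom]
  unfold tauIntWindow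
  have hterm : ∀ k ∈ range t,
      piInner (fun x => ∑ u, J x u) g g * r ^ (k + 1) / (piInner (fun x => ∑ u, J x u) g g * r ^ 0)
        ≤ piInner (fun x => ∑ u, J x u) g ((daKernel J ^ (k + 1)) *ᵥ g)
          / piInner (fun x => ∑ u, J x u) g ((daKernel J ^ 0) *ᵥ g) := by
    intro k _
    rw [pow_zero, mul_one, mul_div_cancel_left₀ _ h0.ne']
    exact da_autocorr_ge_pow hJ hp hm g h0 (k + 1)
  have := sum_le_sum hterm
  dsimp only
  linarith

/-- **`τ_int ≥ (1 + ρ₁)/(1 − ρ₁)`** (`ρ₁ = C_1/C_0 < 1`) for the `N → ∞` integrated autocorrelation time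
of a data-augmentation chain, whenever its autocorrelations are summable. [cite: Berg2004, §4.1
eq. (4.12), (4.16); Liu2001MonteCarlo, §12.6 with §6.6.1] -/
theorem da_tauIntInf_ge (hJ : ∀ x u, 0 ≤ J x u) (hp : ∀ x, 0 < ∑ u, J x u)
    (hm : ∀ u, 0 < ∑ x, J x u) (g : X → ℝ)
    (h0 : 0 < piInner (fun x => ∑ u, J x u) g g)
    (hr1 : piInner (fun x => ∑ u, J x u) g (daKernel J *ᵥ g) < piInner (fun x => ∑ u, J x u) g g)
    (hs : Summable fun k => piInner (fun x => ∑ u, J x u) g ((daKernel J ^ (k + 1)) *ᵥ g)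
      / piInner (fun x => ∑ u, J x u) g ((daKernel J ^ 0) *ᵥ g)) :
    (1 + piInner (fun x => ∑ u, J x u) g (daKernel J *ᵥ g) / piInner (fun x => ∑ u, J x u) g g)
        / (1 - piInner (fun x => ∑ u, J x u) g (daKernel J *ᵥ g) / piInner (fun x => ∑ u, J x u) g g)
      ≤ tauIntInf (fun k => piInner (fun x => ∑ u, J x u) g ((daKernel J ^ k) *ᵥ g)) := by
  set r := piInner (fun x => ∑ u, J x u) g (daKernel J *ᵥ g) / piInner (fun x => ∑ u, J x u) g g
    with hr
  have hrlt : r < 1 := (div_lt_one h0).mpr hr1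
  have hr0 : 0 ≤ r := div_nonneg (by simpa using da_autocov_nonneg hJ hp hm 1 g) h0.le
  have hgeom := tauIntInf_geometric' (C := fun k => piInner (fun x => ∑ u, J x u) g g * r ^ k)
    (c := piInner (fun x => ∑ u, J x u) g g) (r := r) (fun k => rfl) h0.ne' hr0 hrlt
  rw [← hgeom]
  unfold tauIntInf
  have hsg : Summable fun k => piInner (fun x => ∑ u, J x u) g g * r ^ (k + 1)
      / (piInner (fun x => ∑ u, J x u) g g * r ^ 0) :=
    summable_autocorr_geometric (C := fun k => piInner (fun x => ∑ u, J x u) g g * r ^ k)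
      (fun k => rfl) h0.ne' hr0 hrlt
  have hle : ∀ k, piInner (fun x => ∑ u, J x u) g g * r ^ (k + 1)
        / (piInner (fun x => ∑ u, J x u) g g * r ^ 0)
      ≤ piInner (fun x => ∑ u, J x u) g ((daKernel J ^ (k + 1)) *ᵥ g)
        / piInner (fun x => ∑ u, J x u) g ((daKernel J ^ 0) *ᵥ g) := by
    intro k
    rw [pow_zero, mul_one, mul_div_cancel_left₀ _ h0.ne']
    exact da_autocorr_ge_pow hJ hp hm g h0 (k + 1)
  have := Summable.tsum_le_tsum hle hsg hs
  dsimp only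
  linarith

end Literature.Probability.MarkovChains
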